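import Summits.ResolutionOfSingularities.ResolutionOfSingularities.Theorems.WildConesCampaignW46HypersurfacesCharTwoCensusWitnessLeaf
import Summits.ResolutionOfSingularities.ResolutionOfSingularities.Theorems.WildConesCampaignW46HypersurfacesCharTwoDFour

/-!
# [OURS · L1 W4.6, rung (ii) at p = 2] KERNEL WITNESSES FOR THE CORANK-TWO CENSUS: the surface double
# points `z² = x²y + xy²` (three tangents: `h₂ = 1`, exactly THREE near double points, all free) and
# `z² = x²y + xy⁴` (multiple tangent: `h₂ = 2`, exactly ONE satellite and ONE free near double point) —
# over every field of characteristic 2; the first `(e, h₂) = (2, 2)` state in the kernel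

HONEST FRAMING. Everything here is OURS: theorems about route WildCones' own TYPED point-blow-up dynamics
(`Theorems/WildConesClassicalRegimesDefs.lean`) and the seat's invariants `polarMatrix` (p502936),
`milnorEmbDim` (p498937), `milnorHilbertTwo` (p511581), `degForm` (p522667). NOTHING here is a statement
of the manuscript [Hironaka2017]; no FACT-LIST premise; AI review is weaker than expert review. Cell
res-hironaka (LADDER-RESOLUTION rung L, D-0089), slot W4.6, seat res-L1-s46-pv-4 (gen 6); host route
`WildCones`, crux `ClassicalRegimes` (stmt-ResolutionOfSingularities-16884; proved).

WHY. Non-vacuity of the gen-6 census predicates (`…HypersurfacesCharTwoCensusStatement.lean`) and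
sharpness of their counts, in the smallest dimension `n = 2` (pair-free surface double points: polar
matrix `P = 0`, kernel = everything, `e = 2`). The values of `h₂` are obtained WITHOUT any jet
computation, from the null-polar criteria of p542945 (`h₂ = 1 ⟺ N = 0`, `h₂ = 2 ⟺ N` a line) — the
intended use of those criteria.

* `x²y + xy²` (`threeTangents`): `∂ = (y², x²)`, `𝔪³ ≤ (∂a)`: isolated; polars `polar(λ, v) = λ₀v₁² + λ₁v₀²`,
  no null polar ⇒ `h₂ = 1` (and `μ = 4`, p517564); the near vectors `(1,0)`, `(0,1)`, `(1,1)` are the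
  three roots of the cubic `st(s+t)`: THREE double successors, pairwise non-proportional near vectors,
  each of corank `0` (free) — the census bound `≤ 3` of p543928 is attained.
* `x²y + xy⁴` (`multipleTangent`): `∂ = (y⁴, x²)`, `𝔪⁵ ≤ (∂a)`: isolated; polars `polar(λ, v) = λ₁v₀²`:
  `(1,0)` is a non-zero null polar and `polar((0,1),(1,0)) = 1 ≠ 0` ⇒ `h₂ = 2`; the tangent cubic is
  `s²t`: the near vector `(0,1)` (double root) gives a double successor of corank `2` (SATELLITE), the
  near vector `(1,0)` (simple root) one of corank `0` (FREE) — both census bounds `≤ 1` of p536239 and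
  the FreePoints file are attained, `≤ 2` near points in all.

References: [CasasAlvero2000] §3 (free/satellite: context only); [GreuelPfister2026] (context);
[Hironaka2017] Th. 16.6 p.84 — role replaced only, under adjudication; nothing of it is used.
-/

noncomputable section

-- single-problem summit: the doubled namespace component `ResolutionOfSingularities` is forced
set_option linter.dupNamespace false

open scoped BigOperators Classical

open MvPowerSeries IsLocalRing

open Literature.AlgebraicGeometry.Resolution

namespace Summit.ResolutionOfSingularities.ResolutionOfSingularities.Theorems

namespace CampaignW46.HypersurfacesCharTwo

open WildCones WildCones.MuDropCharTwoOrdP ThreefoldsCharTwo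

variable {κ : Type} [Field κ]

/-! ## The exponents -/

/-- [OURS · L1 W4.6] The exponent `(1,2)` evaluated. [folklore] -/
theorem exp12_apply : (Finsupp.single 0 1 + Finsupp.single 1 2 : Fin 2 →₀ ℕ) 0 = 1 ∧
    (Finsupp.single 0 1 + Finsupp.single 1 2 : Fin 2 →₀ ℕ) 1 = 2 := by
  simp

/-- [OURS · L1 W4.6] The exponent `(1,4)` evaluated. [folklore] -/
theorem exp14_apply : (Finsupp.single 0 1 + Finsupp.single 1 4 : Fin 2 →₀ ℕ) 0 = 1 ∧
    (Finsupp.single 0 1 + Finsupp.single 1 4 : Fin 2 →₀ ℕ) 1 = 4 := by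
  simp

/-- [OURS · L1 W4.6] The exponent `(1,2)` has degree `3`. [folklore] -/
theorem exp12_degree : (Finsupp.single 0 1 + Finsupp.single 1 2 : Fin 2 →₀ ℕ).degree = 3 := by
  rw [map_add, Finsupp.degree_single, Finsupp.degree_single]

/-- [OURS · L1 W4.6] The exponent `(1,4)` has degree `5`. [folklore] -/
theorem exp14_degree : (Finsupp.single 0 1 + Finsupp.single 1 4 : Fin 2 →₀ ℕ).degree = 5 := by
  rw [map_add, Finsupp.degree_single, Finsupp.degree_single]

/-- [OURS · L1 W4.6] `(2,1) ≠ (1,2)`. [folklore] -/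
theorem exp21_ne_exp12 :
    (Finsupp.single 0 2 + Finsupp.single 1 1 : Fin 2 →₀ ℕ) ≠ Finsupp.single 0 1 + Finsupp.single 1 2 := by
  intro h; have := DFunLike.congr_fun h 0; rw [exp21_apply.1, exp12_apply.1] at this; omega

/-- [OURS · L1 W4.6] `(2,1) ≠ (1,4)`. [folklore] -/
theorem exp21_ne_exp14 :
    (Finsupp.single 0 2 + Finsupp.single 1 1 : Fin 2 →₀ ℕ) ≠ Finsupp.single 0 1 + Finsupp.single 1 4 := by
  intro h; have := DFunLike.congr_fun h 0; rw [exp21_apply.1, exp14_apply.1] at this; omega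

/-! ### The three-tangents witness: `h₂ = 1`, three free near points -/

/-- [OURS · L1 W4.6 rung (ii) at `p = 2`, `n = 2`; NOT a statement of the manuscript] **`x²y + xy²`: an
isolated pair-free (corank-two) double point with `h₂ = 1` and `μ = 4`** — `h₂` from the null-polar
criterion p542945: `polar(λ, v) = λ₀v₁² + λ₁v₀²` has no non-zero null polar. [folklore] -/
theorem threeTangents_invariants [CharP κ 2] {c : (Fin 2 → ℕ) → κ}
    (hc : ser 2 2 κ c = (monomial (Finsupp.single 0 2 + Finsupp.single 1 1) (1 : κ) +
      monomial (Finsupp.single 0 1 + Finsupp.single 1 2) 1 : MvPowerSeries (Fin 2) κ)) :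
    MultP 2 2 κ c ∧ ¬ OrdP 2 2 κ c ∧ Isol 2 2 κ c ∧ milnorEmbDim 2 2 κ c = 2 ∧
      milnorHilbertTwo 2 2 κ c = 1 ∧ mu 2 2 κ c = 4 := by
  have hM : MultP 2 2 κ c := multP_of_ser_eq_monomial_add exp21_ne_exp12 (by rw [exp21_degree]; norm_num)
    (by rw [exp12_degree]; norm_num) hc
  have hO : ¬ OrdP 2 2 κ c := not_ordP_of_ser_eq_monomial_add (by rw [exp21_degree]; norm_num)
    (by rw [exp12_degree]; norm_num) hc
  have hI : Isol 2 2 κ c := isol_of_ser_eq_e21_add_single (k := 2) (dvd_refl 2) hc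
  have he : milnorEmbDim 2 2 κ c = 2 := (not_ordP_iff_milnorEmbDim_eq hM).mp hO
  have hh : milnorHilbertTwo 2 2 κ c = 1 := by
    refine (hypersurface_milnorHilbertTwo_eq_one_iff_no_null_polar c hM he).mpr fun lam _ hnull => ?_
    have h0 := hnull ![0, 1] (vecMul_polarMatrix_of_not_ordP hO _)
    have h1 := hnull ![1, 0] (vecMul_polarMatrix_of_not_ordP hO _)
    rw [hc, polar_e21_add_single (k := 2) (dvd_refl 2), if_pos rfl] at h0 h1
    simp only [Matrix.cons_val_zero, Matrix.cons_val_one, one_pow, mul_one,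
      zero_pow (two_ne_zero), mul_zero, add_zero, zero_add] at h0 h1
    funext s
    fin_cases s
    · exact h0
    · exact h1
  exact ⟨hM, hO, hI, he, hh, ((hypersurface_milnorHilbertTwo_eq_one_iff c hM he).mp hh).2⟩

/-- [OURS · L1 W4.6 rung (ii) at `p = 2`, `n = 2`; NOT a statement of the manuscript] **`x²y + xy²` HAS
THREE FREE NEAR DOUBLE POINTS**: the charts/translations with near vectors `(1,0)`, `(0,1)`, `(1,1)` —
the three roots of the tangent cubic `st(s+t)` — give double successors of corank `0` (free: isolated,
`μ = 1`, nothing after), and the three near vectors are pairwise non-proportional; by the census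
(p543928) there is no fourth. [folklore] -/
theorem threeTangents_near_points [CharP κ 2] {c : (Fin 2 → ℕ) → κ}
    (hc : ser 2 2 κ c = (monomial (Finsupp.single 0 2 + Finsupp.single 1 1) (1 : κ) +
      monomial (Finsupp.single 0 1 + Finsupp.single 1 2) 1 : MvPowerSeries (Fin 2) κ)) :
    (MultP 2 2 κ (step 2 2 κ 0 0 c) ∧ milnorEmbDim 2 2 κ (step 2 2 κ 0 0 c) = 0) ∧
      (MultP 2 2 κ (step 2 2 κ 1 0 c) ∧ milnorEmbDim 2 2 κ (step 2 2 κ 1 0 c) = 0) ∧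
      (MultP 2 2 κ (step 2 2 κ 0 (fun _ => 1) c) ∧ milnorEmbDim 2 2 κ (step 2 2 κ 0 (fun _ => 1) c) = 0) ∧
      (∀ r : κ, Function.update (0 : Fin 2 → κ) 1 1 ≠ r • Function.update (0 : Fin 2 → κ) 0 1) ∧
      (∀ r : κ, Function.update (fun _ => (1 : κ)) (0 : Fin 2) 1 ≠ r • Function.update (0 : Fin 2 → κ) 0 1) ∧
      (∀ r : κ, Function.update (fun _ => (1 : κ)) (0 : Fin 2) 1 ≠ r • Function.update (0 : Fin 2 → κ) 1 1) := by
  obtain ⟨hM, hO, hI, he, -, -⟩ := threeTangents_invariants hc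
  have hker := vecMul_polarMatrix_of_not_ordP hO
  have hcub : ∀ w : Fin 2 → κ, degForm 3 (ser 2 2 κ c) w = w 0 ^ 2 * w 1 + w 0 * w 1 ^ 2 := by
    intro w
    rw [hc, degForm_add, degForm_monomial exp21_degree, degForm_monomial exp12_degree,
      Fin.prod_univ_two, Fin.prod_univ_two, exp21_apply.1, exp21_apply.2, exp12_apply.1, exp12_apply.2]
    ring
  have hpol : ∀ lam v : Fin 2 → κ, ∑ s, lam s * degForm 2 (MvPowerSeries.pderiv s (ser 2 2 κ c)) v =
      lam 0 * v 1 ^ 2 + lam 1 * v 0 ^ 2 := by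
    intro lam v
    rw [hc, polar_e21_add_single (k := 2) (dvd_refl 2), if_pos rfl]
  -- the three near vectors
  have hw₁ : Function.update (0 : Fin 2 → κ) 0 1 = ![1, 0] := by
    funext s; fin_cases s <;> simp
  have hw₂ : Function.update (0 : Fin 2 → κ) 1 1 = ![0, 1] := by
    funext s; fin_cases s <;> simp
  have hw₃ : Function.update (fun _ => (1 : κ)) (0 : Fin 2) 1 = ![1, 1] := by
    funext s; fin_cases s <;> simp
  have h11 : (1 : κ) + 1 = 0 := CharTwo.add_self_eq_zero 1
  -- double successors
  have hM₁ : MultP 2 2 κ (step 2 2 κ 0 0 c) := by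
    refine (hypersurface_multP_step_iff c 0 0 hM hI).mpr ⟨hker _, ?_⟩
    rw [hcub, hw₁]; simp
  have hM₂ : MultP 2 2 κ (step 2 2 κ 1 0 c) := by
    refine (hypersurface_multP_step_iff c 1 0 hM hI).mpr ⟨hker _, ?_⟩
    rw [hcub, hw₂]; simp
  have hM₃ : MultP 2 2 κ (step 2 2 κ 0 (fun _ => 1) c) := by
    refine (hypersurface_multP_step_iff c 0 _ hM hI).mpr ⟨hker _, ?_⟩
    rw [hcub, hw₃]; simp [h11]
  refine ⟨⟨hM₁, ?_⟩, ⟨hM₂, ?_⟩, ⟨hM₃, ?_⟩, fun r h => ?_, fun r h => ?_, fun r h => ?_⟩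
  · refine (hypersurface_milnorEmbDim_step_eq_zero_iff c 0 0 hM he hM₁).mpr ⟨![0, 1], hker _, ?_⟩
    rw [hpol, hw₁]; simp
  · refine (hypersurface_milnorEmbDim_step_eq_zero_iff c 1 0 hM he hM₂).mpr ⟨![1, 0], hker _, ?_⟩
    rw [hpol, hw₂]; simp
  · refine (hypersurface_milnorEmbDim_step_eq_zero_iff c 0 _ hM he hM₃).mpr ⟨![1, 0], hker _, ?_⟩
    rw [hpol, hw₃]; simp
  · have := congrFun h 1; rw [hw₂, hw₁] at this; simp at this
  · have := congrFun h 1; rw [hw₃, hw₁] at this; simp at this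
  · have := congrFun h 0; rw [hw₃, hw₂] at this; simp at this

/-! ### The multiple-tangent witness: `h₂ = 2`, one satellite and one free near point -/

/-- [OURS · L1 W4.6 rung (ii) at `p = 2`, `n = 2`; NOT a statement of the manuscript] **`x²y + xy⁴`: an
isolated pair-free (corank-two) double point with `h₂ = 2`** — from the null-polar criterion p542945:
`polar(λ, v) = λ₁v₀²`, so `(1,0)` is a non-zero null polar while `polar((0,1),(1,0)) = 1 ≠ 0`. The first
kernel witness of the multiple-tangent class `(e, h₂) = (2, 2)`. [folklore] -/
theorem multipleTangent_invariants [CharP κ 2] {c : (Fin 2 → ℕ) → κ}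
    (hc : ser 2 2 κ c = (monomial (Finsupp.single 0 2 + Finsupp.single 1 1) (1 : κ) +
      monomial (Finsupp.single 0 1 + Finsupp.single 1 4) 1 : MvPowerSeries (Fin 2) κ)) :
    MultP 2 2 κ c ∧ ¬ OrdP 2 2 κ c ∧ Isol 2 2 κ c ∧ milnorEmbDim 2 2 κ c = 2 ∧
      milnorHilbertTwo 2 2 κ c = 2 := by
  have hM : MultP 2 2 κ c := multP_of_ser_eq_monomial_add exp21_ne_exp14 (by rw [exp21_degree]; norm_num)
    (by rw [exp14_degree]; norm_num) hc
  have hO : ¬ OrdP 2 2 κ c := not_ordP_of_ser_eq_monomial_add (by rw [exp21_degree]; norm_num)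
    (by rw [exp14_degree]; norm_num) hc
  have hI : Isol 2 2 κ c := isol_of_ser_eq_e21_add_single (k := 4) ⟨2, rfl⟩ hc
  have he : milnorEmbDim 2 2 κ c = 2 := (not_ordP_iff_milnorEmbDim_eq hM).mp hO
  have hker := vecMul_polarMatrix_of_not_ordP hO
  have hpol : ∀ lam v : Fin 2 → κ, ∑ s, lam s * degForm 2 (MvPowerSeries.pderiv s (ser 2 2 κ c)) v =
      lam 1 * v 0 ^ 2 := by
    intro lam v
    rw [hc, polar_e21_add_single (k := 4) ⟨2, rfl⟩, if_neg (by norm_num), mul_zero, zero_add]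
  have hh : milnorHilbertTwo 2 2 κ c = 2 := by
    refine (hypersurface_milnorHilbertTwo_eq_two_iff_null_polar_line c hM he).mpr ⟨⟨![1, 0], ?_, hker _, ?_⟩,
      ⟨![0, 1], ![1, 0], hker _, hker _, ?_⟩⟩
    · intro h; have := congrFun h 0; simp at this
    · intro v _; rw [hpol]; simp
    · rw [hpol]; simp
  exact ⟨hM, hO, hI, he, hh⟩

/-- [OURS · L1 W4.6 rung (ii) at `p = 2`, `n = 2`; NOT a statement of the manuscript] **`x²y + xy⁴` HAS
ONE SATELLITE AND ONE FREE NEAR DOUBLE POINT**: the chart `u₁` at the origin (near vector `(0,1)`, the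
double root of the tangent cubic `s²t`) gives a double successor of corank `2` — a SATELLITE, isolated
with smaller `μ` —, the chart `u₀` at the origin (near vector `(1,0)`, the simple root) one of corank `0`
— FREE, `μ = 1`, nothing after it. By the census (p536239, the FreePoints file) there are no others:
both bounds `≤ 1` are attained. [folklore] -/
theorem multipleTangent_near_points [CharP κ 2] {c : (Fin 2 → ℕ) → κ}
    (hc : ser 2 2 κ c = (monomial (Finsupp.single 0 2 + Finsupp.single 1 1) (1 : κ) +
      monomial (Finsupp.single 0 1 + Finsupp.single 1 4) 1 : MvPowerSeries (Fin 2) κ)) :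
    (MultP 2 2 κ (step 2 2 κ 1 0 c) ∧ milnorEmbDim 2 2 κ (step 2 2 κ 1 0 c) = 2 ∧
        Isol 2 2 κ (step 2 2 κ 1 0 c) ∧ mu 2 2 κ (step 2 2 κ 1 0 c) < mu 2 2 κ c) ∧
      (MultP 2 2 κ (step 2 2 κ 0 0 c) ∧ milnorEmbDim 2 2 κ (step 2 2 κ 0 0 c) = 0 ∧
        Isol 2 2 κ (step 2 2 κ 0 0 c) ∧ mu 2 2 κ (step 2 2 κ 0 0 c) = 1 ∧
          ∀ (i' : Fin 2) (τ' : Fin 2 → κ), ¬ MultP 2 2 κ (step 2 2 κ i' τ' (step 2 2 κ 0 0 c))) := by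
  obtain ⟨hM, hO, hI, he, hh⟩ := multipleTangent_invariants hc
  have hker := vecMul_polarMatrix_of_not_ordP hO
  have hcub : ∀ w : Fin 2 → κ, degForm 3 (ser 2 2 κ c) w = w 0 ^ 2 * w 1 := by
    intro w
    rw [hc, degForm_three_monomial_add exp21_degree (by rw [exp14_degree]; norm_num),
      Fin.prod_univ_two, exp21_apply.1, exp21_apply.2, pow_one]
  have hpol : ∀ lam v : Fin 2 → κ, ∑ s, lam s * degForm 2 (MvPowerSeries.pderiv s (ser 2 2 κ c)) v =
      lam 1 * v 0 ^ 2 := by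
    intro lam v
    rw [hc, polar_e21_add_single (k := 4) ⟨2, rfl⟩, if_neg (by norm_num), mul_zero, zero_add]
  have hw₁ : Function.update (0 : Fin 2 → κ) 0 1 = ![1, 0] := by
    funext s; fin_cases s <;> simp
  have hw₂ : Function.update (0 : Fin 2 → κ) 1 1 = ![0, 1] := by
    funext s; fin_cases s <;> simp
  -- the satellite
  have hMs : MultP 2 2 κ (step 2 2 κ 1 0 c) := by
    refine (hypersurface_multP_step_iff c 1 0 hM hI).mpr ⟨hker _, ?_⟩
    rw [hcub, hw₂]; simp
  have hes : milnorEmbDim 2 2 κ (step 2 2 κ 1 0 c) = 2 := by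
    refine (hypersurface_milnorEmbDim_step_eq_two_iff c 1 0 hM he hMs).mpr fun v _ => ?_
    rw [hpol, hw₂]; simp
  -- the free point
  have hMf : MultP 2 2 κ (step 2 2 κ 0 0 c) := by
    refine (hypersurface_multP_step_iff c 0 0 hM hI).mpr ⟨hker _, ?_⟩
    rw [hcub, hw₁]; simp
  have hfree : ∑ s, (![0, 1] : Fin 2 → κ) s * degForm 2 (MvPowerSeries.pderiv s (ser 2 2 κ c))
      (Function.update (0 : Fin 2 → κ) 0 1) ≠ 0 := by
    rw [hpol, hw₁]; simp
  have hef := (hypersurface_milnorEmbDim_step_eq_zero_iff c 0 0 hM he hMf).mpr ⟨![0, 1], hker _, hfree⟩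
  exact ⟨⟨hMs, hes, hypersurface_isol_step_of_milnorHilbertTwo_le_two c 1 0 hM hI he (by omega) hMs⟩,
    ⟨hMf, hef, hypersurface_simple_tangent_resolved c 0 0 hM he hMf (hker _) hfree⟩⟩

/-! ### Existence over every field of characteristic two -/

/-- [OURS · L1 W4.6 rung (ii) at `p = 2`; NOT a statement of the manuscript] **THE CENSUS IS SHARP AND ITS
CLASSES ARE INHABITED**, over every field of characteristic `2`, already for surfaces (`n = 2`): there is
an isolated corank-two double state with `h₂ = 1` having THREE pairwise non-proportional free near
double points (`x²y + xy²`), and one with `h₂ = 2` having a satellite AND a free near double point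
(`x²y + xy⁴`). Non-vacuity of the census predicates `CampaignW46Hypersurfaces{HilbertOneCensus,
CorankTwoCountHilbert, HilbertTwoCount, FreeUnique, SuccessorDichotomy, HilbertTwoIffNullPolarLine,
HilbertOneIffNoNullPolar}` at `p = 2`, `n = 2`, with the predicted conclusions attained. [folklore] -/
theorem surface_census_witnesses (κ : Type) [Field κ] [CharP κ 2] :
    (∃ c : (Fin 2 → ℕ) → κ, MultP 2 2 κ c ∧ Isol 2 2 κ c ∧ milnorEmbDim 2 2 κ c = 2 ∧
      milnorHilbertTwo 2 2 κ c = 1 ∧ mu 2 2 κ c = 4 ∧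
      (MultP 2 2 κ (step 2 2 κ 0 0 c) ∧ milnorEmbDim 2 2 κ (step 2 2 κ 0 0 c) = 0) ∧
      (MultP 2 2 κ (step 2 2 κ 1 0 c) ∧ milnorEmbDim 2 2 κ (step 2 2 κ 1 0 c) = 0) ∧
      (MultP 2 2 κ (step 2 2 κ 0 (fun _ => 1) c) ∧ milnorEmbDim 2 2 κ (step 2 2 κ 0 (fun _ => 1) c) = 0)) ∧
    (∃ c : (Fin 2 → ℕ) → κ, MultP 2 2 κ c ∧ Isol 2 2 κ c ∧ milnorEmbDim 2 2 κ c = 2 ∧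
      milnorHilbertTwo 2 2 κ c = 2 ∧
      (MultP 2 2 κ (step 2 2 κ 1 0 c) ∧ milnorEmbDim 2 2 κ (step 2 2 κ 1 0 c) = 2) ∧
      (MultP 2 2 κ (step 2 2 κ 0 0 c) ∧ milnorEmbDim 2 2 κ (step 2 2 κ 0 0 c) = 0)) := by
  constructor
  · obtain ⟨c, hc⟩ := exists_ser_eq_witness (κ := κ) (Finsupp.single 0 1 + Finsupp.single 1 2)
      (by rw [exp12_apply.1]; omega)
    obtain ⟨hM, -, hI, he, hh, hμ⟩ := threeTangents_invariants hc
    obtain ⟨h₁, h₂, h₃, -, -, -⟩ := threeTangents_near_points hc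
    exact ⟨c, hM, hI, he, hh, hμ, h₁, h₂, h₃⟩
  · obtain ⟨c, hc⟩ := exists_ser_eq_witness (κ := κ) (Finsupp.single 0 1 + Finsupp.single 1 4)
      (by rw [exp14_apply.1]; omega)
    obtain ⟨hM, -, hI, he, hh⟩ := multipleTangent_invariants hc
    obtain ⟨⟨hMs, hes, -, -⟩, hMf, hef, -⟩ := multipleTangent_near_points hc
    exact ⟨c, hM, hI, he, hh, ⟨hMs, hes⟩, hMf, hef⟩

end CampaignW46.HypersurfacesCharTwo

end Summit.ResolutionOfSingularities.ResolutionOfSingularities.Theorems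

end
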